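import Literature.AlgebraicGeometry.Motives.HodgeStructureCentralizerIsotypicBlock
import Literature.AlgebraicGeometry.Motives.HodgeStructureLefschetzGroupInternalBlocks
import Literature.AlgebraicGeometry.Motives.HodgeTensorFactsHolds
import HarnessLib

/-!
# MILNE'S PROP. 1.5 ON THE ISOTYPIC BLOCKS: `S(H)(ℚ)` transports along Hodge isomorphisms for ANY polarizations, `S(⊕ᵢ Tᵢ)(ℚ) ≃*
# S(H₀)(ℚ)` for an internal direct sum of copies `Tᵢ ≅ H₀`, hence `S(H)(ℚ) ≃* Π_k S(T_k)(ℚ)` over the REPRESENTATIVES `T_k` of the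
# isotypy classes of any labelled irreducible decomposition («`S(A₁) × ⋯ × S(A_s) → S(A)` is an isomorphism», `Aᵢ` representatives
# of the simple isogeny factors), and `S(S)(ℚ) ≃* S(U)(ℚ)` for a canonical block `S ⊇ U` irreducible (Milne 1999 §1 Prop. 1.5)

[topic AlgebraicGeometry/Motives]

Layer `Literature/AlgebraicGeometry/Motives`, lane `lit-hodgefound` (Track 2 foundations library; prover seat
`lit-hodgefound-p02`, generation 52, self-proposed row g52-#6). THEOREMS ONLY: no definition, no named fact (net debt `0`),
no instance, no notation.  The Lefschetz-group companion of g52-#5 `Motives/HodgeStructureCentralizerIsotypicBlock` (`C(H') ≃ₐ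
C(H₀)`, `C(H) ≃ₐ Π_k C(T_k)`), joining BY NAME (nothing restated): p34's `Polarization.lefschetzGroup` (`S(H)(ℚ)`), its
polarization-independence `Polarization.lefschetzGroup_eq_of_polarization` (`Motives/HodgeStructureLefschetzGroupPoints`; its
`HodgeTensorFacts` instance hypothesis is discharged here by the tree's `hodgeTensorFacts_holds`, `Motives/HodgeTensorFactsHolds`),
the transport `Polarization.lefschetzGroupComapEquivMulEquiv : S(e^* H)(ℚ) ≃* S(H)(ℚ)` (`Motives/HodgeStructureLefschetzGroupTransport`),
the diagonal `Polarization.lefschetzGroupPiConstMulEquiv : S(H₀)(ℚ) ≃* S(H₀^{⊕ι})(ℚ)` (`Motives/HodgeStructureLefschetzGroupFiniteDirectSum`),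
g52-#5's Hodge isomorphism `H₀^{⊕ι} ⥲ H'` (`bijective_piDesc_subtypeHom_comp_toLinearMap`, `eq_comapEquiv_of_hom_bijective`), g52-#4's
`S(H)(ℚ) ≃* Π_k S(W_k)(ℚ)` along Hom-orthogonal internal blocks (`Polarization.exists_mulEquiv_pi_lefschetzGroup_of_hom_orthogonal`,
`Motives/HodgeStructureLefschetzGroupInternalBlocks`), the isotypic blocks `W_k = ⨆_{c i = k} Tᵢ` (`isInternal_iSup'_fiber`,
`hom_iSup'_fiber_eq_zero`, `isInternal_comapSubtype_iSup'_fiber`, `exists_hom_comapSubtype_bijective`;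
`Motives/HodgeStructureIsotypicEndomorphismAlgebra`) and g52-#1 (`existsUnique_iSup'_fiber_eq_of_minimal_stable`,
`exists_hom_bijective_iff_eq_of_minimal_stable`).  p34's `Motives/HodgeStructureLefschetzGroupSimpleIsogenyFactors` gives Prop. 1.5
for the EXTERNAL model `⊕_j H_j^{⊕κ_j}` (`Polarization.lefschetzGroupIsogenyFactorsMulEquiv`); here it is read on the polarized Hodge
structure `(H, ψ)` itself, with `T_k ⊆ V` actual sub-Hodge structures carrying the restricted polarizations `ψ|_{T_k}`.

## The source, verbatim

J. S. Milne, *Lefschetz classes on abelian varieties*, Duke Math. J. 96 (1999) 639–675 [Milne1999LefschetzClasses] (held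
`paper:doi-10-1215-s0012-7094-99-09620-5`), §1 p. 644 L16–L21: "we define `S(A)` to be the algebraic subgroup of `GL(V(A))` such
that, for all commutative `k`-algebras `R`, `S(A)(R) = {γ ∈ C(A) ⊗_k R | γ†γ = 1}`. Thus, for any ample divisor `D` on `A`, `S(A)`
is the largest algebraic subgroup of `Sp(e_D)` whose elements commute with the endomorphisms of `A`. Clearly `S(A)` depends only on
the isogeny class of `A` (up to a unique isomorphism)."; L24–L29: "**Proposition 1.5.** Let `A₁, …, A_s` be a set of representatives
for the simple isogeny factors of `A`, so that there exists an isogeny `A₁^{r₁} × ⋯ × A_s^{r_s} → A` for some `rᵢ > 0`. Any such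
isogeny induces an isomorphism `S(A₁) × ⋯ × S(A_s) → S(A)`, which is independent of the choice of the isogeny. Proof. This is an
immediate consequence of Proposition 1.1."  Also H. Lange [Lange2023AbelianVarietiesComplex] §7.2.4 Exercise (4) (the Lefschetz
group of a polarized abelian variety does not depend on the polarization), C. Voisin [VoisinHodgeI2002] §7.3.1 Lemma 7.23 ∕ 7.26.

## Dictionary and what is proved (namespace `Literature.AlgebraicGeometry.Motives.HodgeStructure`)

`S(H, Q)(ℚ) = Q.lefschetzGroup ≤ GL(V)` (the `g` commuting with `E_φ` and preserving `Q`); `ψ|_S = ψ.restrict S`; an internal direct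
sum `T : ι → SubHodgeStructure H'` (`DirectSum.IsInternal`) with isomorphisms `rᵢ : H₀ ⥲ Tᵢ`; `H₀^{⊕ι} = HodgeStructure.pi (fun _ ↦ H₀)`
with the product polarization `Polarization.pi`.  As in g52-#5 the generic lemmas have a small index type (`ι : Type`) and arbitrary
finite index types are reached by re-indexing along `Fintype.equivFin`.

* §1 `Polarization.lefschetzGroup_eq_of_hodgeStructure_eq` (equal Hodge structures on one carrier, ANY two polarizations: the same
  `S(ℚ)`), **`Polarization.exists_lefschetzGroup_mulEquiv_of_hom_bijective`** («an isogeny … induces an isomorphism»: a Hodge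
  isomorphism `g : H₁ ⥲ H₂` gives `S(H₁, Q₁)(ℚ) ≃* S(H₂, Q₂)(ℚ)`, `γ ↦ g γ g⁻¹`, for ANY polarizations `Q₁`, `Q₂`).
* §2 **`Polarization.nonempty_lefschetzGroup_mulEquiv_of_isInternal_of_forall_bijective`** (`S(H', ψ')(ℚ) ≃* S(H₀, ψ₀)(ℚ)` for an
  internal direct sum of copies of `H₀`, any polarizations) (with a private re-indexing helper).
* §3 **`Polarization.nonempty_lefschetzGroup_restrict_iSup'_fiber_mulEquiv`** (`S(W_k, ψ|_{W_k})(ℚ) ≃* S(T_k, ψ|_{T_k})(ℚ)` for every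
  isotypic block of a labelled irreducible decomposition), **`Polarization.nonempty_lefschetzGroup_mulEquiv_pi_of_labelling`**
  (PROP. 1.5: `S(H)(ℚ) ≃* Π_k S(T_k)(ℚ)` over the representatives).
* §4 **`Polarization.nonempty_lefschetzGroup_restrict_mulEquiv_of_minimal_stable`** (`S` minimal `E_φ`-stable, `U ⊆ S` irreducible:
  `S(S, ψ|_S)(ℚ) ≃* S(U, ψ|_U)(ℚ)`).
-/

noncomputable section

namespace Literature.AlgebraicGeometry.Motives

namespace HodgeStructure

universe u

variable {n : ℤ}

/-! ## §1 «Clearly `S(A)` depends only on the isogeny class of `A`»: transport along a bijective morphism, any polarizations -/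

section Transport

variable {V W : Type u} [AddCommGroup V] [Module ℚ V] [Module.Finite ℚ V] [AddCommGroup W] [Module ℚ W]
  {H₁ : HodgeStructure V n} {H₂ : HodgeStructure W n}

/-- Two (propositionally) equal Hodge structures on one carrier have the same `S(ℚ)` for ANY two polarizations — p34's
polarization-independence `lefschetzGroup_eq_of_polarization` («for any ample divisor `D` … `S(A)` is the largest algebraic subgroup
of `Sp(e_D)` whose elements commute with the endomorphisms»), its `HodgeTensorFacts` hypothesis discharged by `hodgeTensorFacts_holds`.
[cite: Milne1999LefschetzClasses, §1 p. 644 L16–L20] [cite: Lange2023AbelianVarietiesComplex, §7.2.4 Exercise (4) (a)] -/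
theorem Polarization.lefschetzGroup_eq_of_hodgeStructure_eq {H H' : HodgeStructure V n} (h : H = H') (Q : Polarization H)
    (Q' : Polarization H') : Q.lefschetzGroup = Q'.lefschetzGroup := by
  subst h
  haveI : HodgeTensorFacts.{u, u} := hodgeTensorFacts_holds
  exact Q.lefschetzGroup_eq_of_polarization Q'

/-- **«Clearly `S(A)` depends only on the isogeny class of `A`» ∕ «any such isogeny induces an isomorphism»**: a bijective morphism
of Hodge structures `g : H₁ ⥲ H₂` induces `S(H₁, Q₁)(ℚ) ≃* S(H₂, Q₂)(ℚ)`, `γ ↦ g ∘ γ ∘ g⁻¹`, for ANY polarizations `Q₁` of `H₁` and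
`Q₂` of `H₂` (`H₁ = g^* H₂` by g52-#5, p34's transport `S(g^* H₂, g^* Q₂)(ℚ) ≃* S(H₂, Q₂)(ℚ)`, and §1's independence of the polarization).
[cite: Milne1999LefschetzClasses, §1 p. 644 L20–L21 and Prop. 1.5] [cite: VoisinHodgeI2002, §7.3.1 Lemma 7.23] -/
theorem Polarization.exists_lefschetzGroup_mulEquiv_of_hom_bijective (g : Hom H₁ H₂) (hg : Function.Bijective g.toLinearMap)
    (Q₁ : Polarization H₁) (Q₂ : Polarization H₂) :
    ∃ e : Q₁.lefschetzGroup ≃* Q₂.lefschetzGroup,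
      ∀ (γ : Q₁.lefschetzGroup) (v : V), ((e γ : Q₂.lefschetzGroup) : W ≃ₗ[ℚ] W) (g.toLinearMap v) =
        g.toLinearMap ((γ : V ≃ₗ[ℚ] V) v) := by
  have heq := Polarization.lefschetzGroup_eq_of_hodgeStructure_eq (eq_comapEquiv_of_hom_bijective g hg) Q₁
    (Q₂.comapEquiv (LinearEquiv.ofBijective g.toLinearMap hg))
  refine ⟨(MulEquiv.subgroupCongr heq).trans (Q₂.lefschetzGroupComapEquivMulEquiv (LinearEquiv.ofBijective g.toLinearMap hg)),
    fun γ v => ?_⟩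
  rw [MulEquiv.trans_apply, Polarization.coe_lefschetzGroupComapEquivMulEquiv_apply]
  change (LinearEquiv.ofBijective g.toLinearMap hg) ((γ : V ≃ₗ[ℚ] V) ((LinearEquiv.ofBijective g.toLinearMap hg).symm
    ((LinearEquiv.ofBijective g.toLinearMap hg) v))) = _
  rw [LinearEquiv.symm_apply_apply]
  rfl

end Transport

/-! ## §2 `S(⊕ᵢ Tᵢ)(ℚ) ≃* S(H₀)(ℚ)` for an internal direct sum of copies `Tᵢ ≅ H₀` -/

section IsotypicInternal

variable {V' : Type u} [AddCommGroup V'] [Module ℚ V'] [Module.Finite ℚ V'] {H' : HodgeStructure V' n}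
  {W₀ : Type u} [AddCommGroup W₀] [Module ℚ W₀] [Module.Finite ℚ W₀] {H₀ : HodgeStructure W₀ n}
  {ι : Type} [Fintype ι] [DecidableEq ι] (T : ι → SubHodgeStructure H')
  (hT : DirectSum.IsInternal fun i => (T i).toSubmodule)
  (r : ∀ i, Hom H₀ (T i).toHodgeStructure) (hr : ∀ i, Function.Bijective (r i).toLinearMap)

include hT hr

/-- **`S(H', ψ')(ℚ) ≃* S(H₀, ψ₀)(ℚ)` for an internal direct sum `V' = ⊕ᵢ Tᵢ` (`ι ≠ ∅`) of sub-Hodge structures all isomorphic to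
`H₀`**, for ANY polarizations `ψ'` of `H'` and `ψ₀` of `H₀`: transport (§1) along the Hodge isomorphism `H₀^{⊕ι} ⥲ H'` of g52-#5, then
p34's diagonal `S(H₀)(ℚ) ≃* S(H₀^{⊕ι})(ℚ)` («`S(Aᵢ^{rᵢ}) = S(Aᵢ)`», the case `s = 1` of Prop. 1.5).
[cite: Milne1999LefschetzClasses, §1 p. 644 L20–L21 and Prop. 1.5] -/
theorem Polarization.nonempty_lefschetzGroup_mulEquiv_of_isInternal_of_forall_bijective [Nonempty ι] (ψ' : Polarization H')
    (ψ₀ : Polarization H₀) : Nonempty (ψ'.lefschetzGroup ≃* ψ₀.lefschetzGroup) := by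
  obtain ⟨e, -⟩ := Polarization.exists_lefschetzGroup_mulEquiv_of_hom_bijective _
    (bijective_piDesc_subtypeHom_comp_toLinearMap T hT r hr) (Polarization.pi fun _ : ι => ψ₀) ψ'
  exact ⟨e.symm.trans (Polarization.lefschetzGroupPiConstMulEquiv (ι := ι) ψ₀).symm⟩

end IsotypicInternal

/-- Re-indexing an internal direct sum along an equivalence of index types. [folklore] -/
private theorem isInternal_comp_equiv' {V' : Type u} [AddCommGroup V'] [Module ℚ V'] {ι ι' : Type*} [DecidableEq ι] [DecidableEq ι']
    {A : ι → Submodule ℚ V'} (hA : DirectSum.IsInternal A) (e : ι' ≃ ι) :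
    DirectSum.IsInternal fun j => A (e j) := by
  refine (DirectSum.isInternal_submodule_iff_iSupIndep_and_iSup_eq_top _).2 ⟨?_, ?_⟩
  · exact hA.submodule_iSupIndep.comp e.injective
  · rw [e.iSup_comp (g := A)]
    exact hA.submodule_iSup_eq_top

/-! ## §3 Prop. 1.5: `S(H)(ℚ) ≃* Π_k S(T_k)(ℚ)` over the representatives of a labelled irreducible decomposition -/

section Labelled

variable {V : Type u} [AddCommGroup V] [Module ℚ V] [Module.Finite ℚ V] {H : HodgeStructure V n}
  {ι : Type*} [Fintype ι] [DecidableEq ι] (T : ι → SubHodgeStructure H)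
  (hT : DirectSum.IsInternal fun i => (T i).toSubmodule) {κ : Finset ι} {c : ι → κ}
  (hc : ∀ i, ∃ g : Hom (T i).toHodgeStructure (T (c i)).toHodgeStructure, Function.Bijective g.toLinearMap)
  (hκ : ∀ k k' : κ, (∃ g : Hom (T k).toHodgeStructure (T k').toHodgeStructure,
    Function.Bijective g.toLinearMap) → k = k')

include hT hc hκ

/-- **`S(W_k, ψ|_{W_k})(ℚ) ≃* S(T_k, ψ|_{T_k})(ℚ)` for every isotypic block `W_k = ⨆_{c i = k} Tᵢ`** of a labelled irreducible
decomposition of a polarized `(H, ψ)` («`S(Aᵢ^{rᵢ}) = S(Aᵢ)`»: `W_k` is the internal direct sum of the `Tᵢ`, `c i = k`, all `≅ T_k`;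
§2 after re-indexing by `Fin m`). [cite: Milne1999LefschetzClasses, §1 Prop. 1.5 (p. 644)] -/
theorem Polarization.nonempty_lefschetzGroup_restrict_iSup'_fiber_mulEquiv (ψ : Polarization H) (k : κ) :
    Nonempty ((ψ.restrict (SubHodgeStructure.iSup' fun x : {i // c i = k} => T x.1)).lefschetzGroup ≃*
      (ψ.restrict (T k)).lefschetzGroup) := by
  classical
  choose r hr using exists_hom_comapSubtype_bijective T hc k
  let eι := (Fintype.equivFin {i // c i = k}).symm
  haveI : Nonempty (Fin (Fintype.card {i // c i = k})) := ⟨Fintype.equivFin _ ⟨k, apply_coe_eq T hc hκ k⟩⟩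
  exact Polarization.nonempty_lefschetzGroup_mulEquiv_of_isInternal_of_forall_bijective
    (fun j => (SubHodgeStructure.iSup' fun x : {i // c i = k} => T x.1).comapSubtype (T (eι j).1))
    (isInternal_comp_equiv' (isInternal_comapSubtype_iSup'_fiber T hT c k) eι) (fun j => r (eι j)) (fun j => hr (eι j)) _ _

/-- **MILNE'S PROPOSITION 1.5 on the polarized Hodge structure itself: `S(H, ψ)(ℚ) ≃* Π_k S(T_k, ψ|_{T_k})(ℚ)`** over the
representatives `T_k`, `k ∈ κ`, of the isotypy classes of ANY isotypically-labelled irreducible decomposition of a polarized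
finite-dimensional `ℚ`-Hodge structure («any such isogeny induces an isomorphism `S(A₁) × ⋯ × S(A_s) → S(A)`», `Aᵢ` representatives of
the simple isogeny factors): restriction to the Hom-orthogonal isotypic blocks `W_k` (g52-#4), then `S(W_k)(ℚ) ≃* S(T_k)(ℚ)` block by
block. [cite: Milne1999LefschetzClasses, §1 Prop. 1.5 (p. 644)] [cite: Lange2023AbelianVarietiesComplex, §7.2.4 Exercise (4)] -/
theorem Polarization.nonempty_lefschetzGroup_mulEquiv_pi_of_labelling (ψ : Polarization H)
    (hirr : ∀ i, (T i).toHodgeStructure.IsIrreducible) :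
    Nonempty (ψ.lefschetzGroup ≃* Π k : κ, (ψ.restrict (T k)).lefschetzGroup) := by
  classical
  obtain ⟨e, -⟩ := ψ.exists_mulEquiv_pi_lefschetzGroup_of_hom_orthogonal
    (fun k : κ => SubHodgeStructure.iSup' fun x : {i // c i = k} => T x.1) (isInternal_iSup'_fiber T hT c)
    fun k l hkl f => hom_iSup'_fiber_eq_zero T hT hc hκ hirr hkl f
  exact ⟨e.trans (MulEquiv.piCongrRight fun k =>
    Classical.choice (ψ.nonempty_lefschetzGroup_restrict_iSup'_fiber_mulEquiv T hT hc hκ k))⟩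

end Labelled

/-! ## §4 The canonical block: `S(S, ψ|_S)(ℚ) ≃* S(U, ψ|_U)(ℚ)` for a minimal `E_φ`-stable `S ⊇ U` irreducible -/

section Canonical

variable {V : Type u} [AddCommGroup V] [Module ℚ V] [Module.Finite ℚ V] {H : HodgeStructure V n}

/-- **`S(S, ψ|_S)(ℚ) ≃* S(U, ψ|_U)(ℚ)` for a CANONICAL BLOCK**: for a polarized `(H, ψ)`, a minimal non-zero `E_φ`-stable sub-Hodge
structure `S` and an irreducible `U ⊆ S`, the Lefschetz group of `(S, ψ|_S) ≅ U^{⊕m}` is that of `(U, ψ|_U)` («`S(Aᵢ^{rᵢ}) =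
S(Aᵢ)`»; with g52-#4's `S(H)(ℚ) ≃* Π_i S(S_i)(ℚ)` over the canonical blocks this is Prop. 1.5 over the canonical blocks).
[cite: Milne1999LefschetzClasses, §1 Prop. 1.5 (p. 644)] [cite: VoisinHodgeI2002, §7.3.1 Lemma 7.26] -/
theorem Polarization.nonempty_lefschetzGroup_restrict_mulEquiv_of_minimal_stable (ψ : Polarization H) {S U : SubHodgeStructure H}
    (hS : (∀ a ∈ H.endAlg, ∀ v ∈ S.toSubmodule, a v ∈ S.toSubmodule) ∧ S.toSubmodule ≠ ⊥ ∧
      ∀ S' : SubHodgeStructure H, (∀ a ∈ H.endAlg, ∀ v ∈ S'.toSubmodule, a v ∈ S'.toSubmodule) →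
        S'.toSubmodule ≤ S.toSubmodule → S'.toSubmodule = ⊥ ∨ S'.toSubmodule = S.toSubmodule)
    (hU : U.toHodgeStructure.IsIrreducible) (hUS : U.toSubmodule ≤ S.toSubmodule) :
    Nonempty ((ψ.restrict S).lefschetzGroup ≃* (ψ.restrict U).lefschetzGroup) := by
  classical
  have hH : H.IsPolarizable := ⟨ψ⟩
  -- an isotypically-labelled irreducible decomposition of `H`; `S` is one of its blocks `W_k`
  obtain ⟨s, _, κ, c, hint, hirr, hc, hκ⟩ := exists_isInternal_isIrreducible_labelling H hH
  obtain ⟨k, hk, -⟩ := existsUnique_iSup'_fiber_eq_of_minimal_stable (fun x : s => (x : SubHodgeStructure H)) hint hc hκ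
    (fun x => hirr x x.2) hS
  subst hk
  -- `S(W_k)(ℚ) ≃* S(T_k)(ℚ)` (§3) and `S(T_k)(ℚ) ≃* S(U)(ℚ)` (`T_k ≅ U`, both irreducible inside the block; §1)
  obtain ⟨e₁⟩ := ψ.nonempty_lefschetzGroup_restrict_iSup'_fiber_mulEquiv (fun x : s => (x : SubHodgeStructure H)) hint hc hκ k
  have hTk : ((k : s) : SubHodgeStructure H).toSubmodule ≤
      (SubHodgeStructure.iSup' fun x : {i : s // c i = k} => ((x.1 : s) : SubHodgeStructure H)).toSubmodule := by
    rw [SubHodgeStructure.iSup'_toSubmodule]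
    exact le_iSup (fun x : {i : s // c i = k} => ((x.1 : s) : SubHodgeStructure H).toSubmodule)
      ⟨k, apply_coe_eq (fun x : s => (x : SubHodgeStructure H)) hc hκ k⟩
  obtain ⟨g, hg⟩ := (exists_hom_bijective_iff_eq_of_minimal_stable hH hS hS (hirr (k : s) (k : s).2) hU hTk hUS).2 rfl
  obtain ⟨e₂, -⟩ := Polarization.exists_lefschetzGroup_mulEquiv_of_hom_bijective g hg (ψ.restrict (k : s))
    (ψ.restrict U)
  exact ⟨e₁.trans e₂⟩

end Canonical

end HodgeStructure

end Literature.AlgebraicGeometry.Motives
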